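import Mathlib.Analysis.Complex.AbsMax
import Mathlib.Analysis.Complex.LocallyUniformLimit
import Mathlib.Analysis.Analytic.IsolatedZeros
import HarnessLib

/-!
# Hurwitz's theorem on zeros of locally uniform limits

Trunk T-ANT support (complex analysis), used by `Literature/NumberTheory/LFunctions` (closedness of
`{t | H_t has only real zeros}`, Newman 1976, Thm. 3) and by
`Literature/Probability/LatticeModels/IsingLimitLaw.lean` (Lee–Yang limits).

**Hurwitz's theorem** (A. Hurwitz, *Über die Nullstellen der Bessel'schen Function*, Math. Ann. 33
(1889), 246–266; textbook form: J. B. Conway, *Functions of one complex variable I*, 2nd ed.,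
Ch. VII, Thm. 2.5; E. C. Titchmarsh, *The theory of functions*, 2nd ed., §3.45). We prove the
"existence half", which needs no argument principle:

* `Complex.eventually_exists_zero_mem_ball_of_tendstoUniformlyOn`: if `F n → f` uniformly on the
  closed disc `closedBall z₀ r` (`r > 0`), each `F n` is holomorphic on the open disc and continuous
  on the closed disc, `f` is continuous and zero-free on the circle `sphere z₀ r`, and `f z₀ = 0`,
  then eventually every `F n` has a zero in `ball z₀ r`. Proof: otherwise `1 / F n` is holomorphic
  on the disc and the maximum modulus principle bounds `‖1 / F n (z₀)‖` by its maximum on the circle,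
  contradicting `F n z₀ → 0`.
* `Complex.hurwitz_eqOn_zero_or_forall_ne_zero`: on a preconnected open set `U`, a locally uniform
  limit `f` of holomorphic functions `F n` that are (frequently) zero-free on `U` is either
  identically zero on `U` or zero-free on `U`.

Mathlib has the ingredients (`Complex.norm_le_of_forall_mem_frontier_norm_le`,
`TendstoLocallyUniformlyOn.differentiableOn`, `AnalyticAt.eventually_eq_zero_or_eventually_ne_zero`)
but no form of Hurwitz's theorem (searched `urwitz`, `zero.*tendstoLocallyUniformly`).

## References

* A. Hurwitz, Math. Ann. 33 (1889), 246–266.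
* J. B. Conway, *Functions of one complex variable I*, GTM 11, 2nd ed. (1978), Ch. VII, Thm. 2.5
  and Cor. 2.6.
-/

noncomputable section

open Filter Metric Set Topology

namespace Complex

variable {ι : Type*} {l : Filter ι} {F : ι → ℂ → ℂ} {f : ℂ → ℂ} {z₀ : ℂ} {r : ℝ}

/-- **Hurwitz's theorem**, one-disc form (Conway VII.2.5, existence half). If `F n → f` uniformly
on `closedBall z₀ r` with `0 < r`, eventually each `F n` is holomorphic on `ball z₀ r` and
continuous on its closure, `f` is continuous and zero-free on `sphere z₀ r`, and `f z₀ = 0`, then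
eventually each `F n` has a zero in `ball z₀ r`. [cite: Conway1978, Ch. VII Thm. 2.5] -/
theorem eventually_exists_zero_mem_ball_of_tendstoUniformlyOn (hr : 0 < r)
    (hF : ∀ᶠ n in l, DiffContOnCl ℂ (F n) (ball z₀ r))
    (hunif : TendstoUniformlyOn F f l (closedBall z₀ r))
    (hf : ContinuousOn f (sphere z₀ r)) (hf₀ : f z₀ = 0)
    (hsphere : ∀ z ∈ sphere z₀ r, f z ≠ 0) :
    ∀ᶠ n in l, ∃ z ∈ ball z₀ r, F n z = 0 := by
  -- `‖f‖` is bounded below by some `δ > 0` on the circle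
  have hne : (sphere z₀ r).Nonempty := ⟨z₀ + r, by simp [hr.le]⟩
  obtain ⟨w, hw, hmin⟩ := (isCompact_sphere z₀ r).exists_isMinOn hne hf.norm
  set δ := ‖f w‖ with hδ
  have hδpos : 0 < δ := norm_pos_iff.2 (hsphere w hw)
  have hδle : ∀ z ∈ sphere z₀ r, δ ≤ ‖f z‖ := fun z hz ↦ hmin hz
  have hclose := (Metric.tendstoUniformlyOn_iff.1 hunif) (δ / 2) (by positivity)
  filter_upwards [hF, hclose] with n hFn hn
  by_contra hcon
  push Not at hcon
  -- `F n` is zero-free on the closed disc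
  have hne' : ∀ z ∈ closure (ball z₀ r), F n z ≠ 0 := by
    intro z hz
    rw [closure_ball z₀ hr.ne'] at hz
    rcases eq_or_lt_of_le (mem_closedBall.1 hz) with h | h
    · intro h0
      have h1 := hn z hz
      have hzs : z ∈ sphere z₀ r := mem_sphere.2 h
      rw [h0, dist_zero_right] at h1
      linarith [hδle z hzs]
    · exact hcon z (mem_ball.2 h)
  have hinv : DiffContOnCl ℂ (F n)⁻¹ (ball z₀ r) := hFn.inv hne'
  -- maximum modulus for `1 / F n`
  have hbound : ∀ z ∈ frontier (ball z₀ r), ‖(F n)⁻¹ z‖ ≤ (δ / 2)⁻¹ := by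
    intro z hz
    rw [frontier_ball z₀ hr.ne'] at hz
    have h1 := hn z (sphere_subset_closedBall hz)
    have h2 : δ / 2 ≤ ‖F n z‖ := by
      have := norm_sub_norm_le (f z) (F n z)
      rw [← dist_eq_norm] at this
      linarith [hδle z hz]
    rw [Pi.inv_apply, norm_inv]
    exact inv_anti₀ (by positivity) h2
  have hz₀ : z₀ ∈ closure (ball z₀ r) := subset_closure (mem_ball_self hr)
  have key := norm_le_of_forall_mem_frontier_norm_le isBounded_ball hinv hbound hz₀
  have h0 := hn z₀ (mem_closedBall_self hr.le)
  rw [hf₀, dist_zero_left] at h0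
  rw [Pi.inv_apply, norm_inv] at key
  have hpos : 0 < ‖F n z₀‖ := norm_pos_iff.2 (hne' z₀ hz₀)
  have := (inv_le_inv₀ hpos (by positivity)).1 key
  linarith

/-- **Hurwitz's theorem**, zero-free version (Conway VII.2.5 / Cor. 2.6). Let `U ⊆ ℂ` be open and
preconnected, `F n → f` locally uniformly on `U` along a non-trivial filter, with `F n` holomorphic
on `U` eventually and zero-free on `U` frequently. Then either `f` vanishes identically on `U` or
`f` has no zero in `U`. [cite: Conway1978, Ch. VII Thm. 2.5] -/
theorem hurwitz_eqOn_zero_or_forall_ne_zero [l.NeBot] {U : Set ℂ} (hU : IsOpen U)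
    (hU' : IsPreconnected U) (hF : ∀ᶠ n in l, DifferentiableOn ℂ (F n) U)
    (hlim : TendstoLocallyUniformlyOn F f l U) (h0 : ∃ᶠ n in l, ∀ z ∈ U, F n z ≠ 0) :
    EqOn f 0 U ∨ ∀ z ∈ U, f z ≠ 0 := by
  classical
  by_cases hz : ∃ z₀ ∈ U, f z₀ = 0
  swap
  · push Not at hz
    exact Or.inr hz
  obtain ⟨z₀, hz₀U, hfz₀⟩ := hz
  have hdiff : DifferentiableOn ℂ f U := hlim.differentiableOn hF hU
  have han : AnalyticOnNhd ℂ f U := hdiff.analyticOnNhd hU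
  rcases (han z₀ hz₀U).eventually_eq_zero_or_eventually_ne_zero with h | h
  · exact Or.inl (han.eqOn_zero_of_preconnected_of_eventuallyEq_zero hU' hz₀U h)
  -- `z₀` is an isolated zero: choose a closed disc in `U` on whose boundary `f ≠ 0`
  exfalso
  have h' : ∀ᶠ z in 𝓝 z₀, (z ≠ z₀ → f z ≠ 0) ∧ z ∈ U :=
    (eventually_nhdsWithin_iff.1 h).and (hU.mem_nhds hz₀U)
  obtain ⟨r, hr, hball⟩ := Metric.eventually_nhds_iff_ball.1 h'
  have hr2 : 0 < r / 2 := by positivity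
  have hsub : closedBall z₀ (r / 2) ⊆ ball z₀ r := closedBall_subset_ball (by linarith)
  have hKU : closedBall z₀ (r / 2) ⊆ U := fun z hz ↦ (hball z (hsub hz)).2
  have hunif : TendstoUniformlyOn F f l (closedBall z₀ (r / 2)) :=
    (tendstoLocallyUniformlyOn_iff_forall_isCompact hU).1 hlim _ hKU (isCompact_closedBall _ _)
  have hF' : ∀ᶠ n in l, DiffContOnCl ℂ (F n) (ball z₀ (r / 2)) := by
    filter_upwards [hF] with n hn using hn.diffContOnCl_ball hKU
  have hsphere : ∀ z ∈ sphere z₀ (r / 2), f z ≠ 0 := by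
    intro z hz
    refine (hball z (hsub (sphere_subset_closedBall hz))).1 ?_
    rintro rfl
    simp only [mem_sphere, dist_self] at hz
    exact hr2.ne hz
  have hev := eventually_exists_zero_mem_ball_of_tendstoUniformlyOn hr2 hF' hunif
    (hdiff.continuousOn.mono ((sphere_subset_closedBall).trans hKU)) hfz₀ hsphere
  obtain ⟨n, hn0, z, hz, hz0⟩ := (h0.and_eventually hev).exists
  exact hn0 z (hKU (ball_subset_closedBall hz)) hz0

end Complex

end
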